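import Mathlib
import HarnessLib

/-!
# Crux `NNLinearDegreeCofactorHard` (stmt-ValiantsHypothesis-23918), line `internal_cofactor`, stub S2b (ii):
# the SHED QUEUE WORD — definitions (design memo `Lines/internal_cofactor-S2b-shed-design-p1.md`)

A second word measure for S2b, keyed to the queue STATE rather than to the position (the memo's `μ*`): on the
carved window `Fin N` with defect set `R` (the trace of the cofactor's vertex set), fill length `H` and tail
start `E`, the word `shedWord R H E y : Fin N → Bool` (`true` = push `U`, `false` = pop `D`) is read off the bit
string `y : Fin N → Bool` LEFT TO RIGHT, each letter being a function of the PREFIX already written: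

* a defect position ALWAYS pushes (`R ≡ push`: no arc has both ends in `R`, so the FIFO matching avoids `R × R`);
* the first `H` positions push (fill); an empty queue pushes;
* in the tail (`t ≥ E`, non-defect) the first `tailPushes` non-defect tail letters push and the rest pop, with
  `tailPushes = (T − r − h(E)) / 2` (`T`, `r` = non-defect / defect positions of the tail, `h(E)` = height at `E`),
  so that the word ends at height `0` whenever `h(E) ≤ T − r` (the adaptive drain of `…InflateWordDefs`, S5);
* otherwise, if the FRONT item of the queue (the oldest unpopped push) was pushed at a defect position, the letter
  is a pop (SHED: a defect-pushed item is removed the moment it reaches the front, deterministically);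
* otherwise the letter is the bit `y t` (a FAIR letter).

Prefix bookkeeping is done on `List Bool`: `pushes`, `pops`, `nthTrue` (position of the `k`-th push),
`frontPos` (push position of the front item = the `pops`-th push).  Only definitions and their defining value
lemmas here; the prefix condition / ballot-ness / `fifo ∈ 𝓕_R` / lineage lemmas come in the sequel files.
Nothing here bears on VP ≠ VNP (not proved); S2b and the crux stay open; this is infrastructure for ONE design.
-/

-- Sub = Summit single-conjunct layout: the duplicated namespace component is mandated by the tree.
set_option linter.dupNamespace false

namespace Summit.ValiantsHypothesis.ValiantsHypothesis.Theorems.FifoMatching.NNLinearDegreeCofactorHard.ShedWord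

open Finset

/-! ### Prefix bookkeeping on letter lists (`true` = push) -/

/-- Number of pushes (letters `true`) in a prefix. [folklore] -/
def pushes (p : List Bool) : ℕ := p.count true

/-- Number of pops (letters `false`) in a prefix. [folklore] -/
def pops (p : List Bool) : ℕ := p.count false

/-- Position (index in the list) of the `k`-th push (`0`-indexed); the length of the list if there are at most
`k` pushes. [folklore] -/
def nthTrue : List Bool → ℕ → ℕ
  | [], _ => 0
  | true :: _, 0 => 0
  | true :: l, k + 1 => nthTrue l k + 1
  | false :: l, k => nthTrue l k + 1

/-- Push position of the FRONT item of the FIFO queue after the prefix `p`: the oldest unpopped push is the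
`pops p`-th push (`0`-indexed); junk (`= p.length`) when the queue is empty. [folklore] -/
def frontPos (p : List Bool) : ℕ := nthTrue p (pops p)

/-- The height (queue length) after a prefix, as a natural number (`pushes − pops`, truncated). [folklore] -/
def height (p : List Bool) : ℕ := pushes p - pops p

variable {N : ℕ} (R : Finset (Fin N)) (H E : ℕ)

/-- `t` is a defect position (a natural-number index lying in `R`), as a Boolean. [folklore] -/
def isDefect (t : ℕ) : Bool := decide (t ∈ R.map Fin.valEmbedding)

/-- Number of non-defect positions in `[a, b)`. [folklore] -/
def freeCount (a b : ℕ) : ℕ := ((range b).filter fun t => a ≤ t ∧ isDefect R t = false).card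

/-- Number of defect positions in `[a, b)`. [folklore] -/
def defectCount (a b : ℕ) : ℕ := ((range b).filter fun t => a ≤ t ∧ isDefect R t = true).card

/-- The number of tail pushes (adaptive drain): `(T − r − h(E)) / 2` with `T = freeCount E N`, `r = defectCount E N`
and `h(E)` the height of the length-`E` prefix; the first that many non-defect tail letters push. [folklore] -/
def tailPushes (p : List Bool) : ℕ := (freeCount R E N - defectCount R E N - height (p.take E)) / 2

/-- **The letter rule.** Given the prefix `p` (the letters at positions `< t`), the position `t` and the bit `b`:
defect ⟹ push; fill ⟹ push; empty queue ⟹ push; tail ⟹ push iff fewer than `tailPushes` non-defect tail positions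
precede `t`; front pushed at a defect ⟹ pop (shed); otherwise the bit. [folklore] -/
def letter (p : List Bool) (t : ℕ) (b : Bool) : Bool :=
  if isDefect R t then true
  else if t < H then true
  else if pushes p ≤ pops p then true
  else if E ≤ t then decide (freeCount R E t < tailPushes R E p)
  else if isDefect R (frontPos p) then false
  else b

variable (y : Fin N → Bool)

/-- The bit at a natural-number position (`false` beyond `N`). [folklore] -/
def bit (t : ℕ) : Bool := if h : t < N then y ⟨t, h⟩ else false

/-- The prefix of the shed word of length `t` (letters at positions `0, …, t − 1`). [folklore] -/
def shedPrefix : ℕ → List Bool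
  | 0 => []
  | t + 1 => shedPrefix t ++ [letter R H E (shedPrefix t) t (bit y t)]

/-- The shed word on natural-number positions. [folklore] -/
def shedLetter (t : ℕ) : Bool := letter R H E (shedPrefix R H E y t) t (bit y t)

/-- **The shed queue word** on the window `Fin N`. [folklore] -/
def shedWord : Fin N → Bool := fun t => shedLetter R H E y t

/-- A position is FAIR for the bit string `y` (Boolean) if its letter is the bit: non-defect, past the fill, non-empty
queue, before the tail, and the front item was not pushed at a defect. [folklore] -/
def isFair (t : ℕ) : Bool :=
  !isDefect R t && decide (H ≤ t) && decide (pops (shedPrefix R H E y t) < pushes (shedPrefix R H E y t)) &&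
    decide (t < E) && !isDefect R (frontPos (shedPrefix R H E y t))

/-- Item `k` (the `k`-th push, `0`-indexed) is an R-ITEM if it was pushed at a defect position. [folklore] -/
def isRItem (k : ℕ) : Bool := isDefect R (nthTrue (shedPrefix R H E y N) k)

/-! ### Defining value lemmas -/

/-- The empty prefix has no pushes. [folklore] -/
@[simp] theorem pushes_nil : pushes [] = 0 := rfl

/-- The empty prefix has no pops. [folklore] -/
@[simp] theorem pops_nil : pops [] = 0 := rfl

/-- `pushes` of an appended letter. [folklore] -/
@[simp] theorem pushes_append_singleton (p : List Bool) (b : Bool) :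
    pushes (p ++ [b]) = pushes p + (if b then 1 else 0) := by
  cases b <;> simp [pushes, List.count_append]

/-- `pops` of an appended letter. [folklore] -/
@[simp] theorem pops_append_singleton (p : List Bool) (b : Bool) :
    pops (p ++ [b]) = pops p + (if b then 0 else 1) := by
  cases b <;> simp [pops, List.count_append]

/-- `pushes + pops = length`. [folklore] -/
theorem pushes_add_pops (p : List Bool) : pushes p + pops p = p.length := by
  have h := List.count_not_add_count p false
  simpa only [pushes, pops, Bool.not_false] using h

/-- `nthTrue` on the empty list (junk value `0`). [folklore] -/
@[simp] theorem nthTrue_nil (k : ℕ) : nthTrue [] k = 0 := rfl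

/-- The `0`-th push of a list starting with a push is at position `0`. [folklore] -/
@[simp] theorem nthTrue_true_zero (l : List Bool) : nthTrue (true :: l) 0 = 0 := rfl

/-- A leading push shifts the later pushes by one. [folklore] -/
@[simp] theorem nthTrue_true_succ (l : List Bool) (k : ℕ) : nthTrue (true :: l) (k + 1) = nthTrue l k + 1 := rfl

/-- A leading pop shifts all pushes by one. [folklore] -/
@[simp] theorem nthTrue_false (l : List Bool) (k : ℕ) : nthTrue (false :: l) k = nthTrue l k + 1 := by
  cases k <;> rfl

/-- `nthTrue l k ≤ l.length`. [folklore] -/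
theorem nthTrue_le_length : ∀ (l : List Bool) (k : ℕ), nthTrue l k ≤ l.length
  | [], _ => le_rfl
  | true :: l, 0 => Nat.zero_le _
  | true :: l, k + 1 => by simpa using nthTrue_le_length l k
  | false :: l, k => by simpa using nthTrue_le_length l k

/-- `nthTrue l k < l.length` iff the list has more than `k` pushes. [folklore] -/
theorem nthTrue_lt_length_iff : ∀ (l : List Bool) (k : ℕ), nthTrue l k < l.length ↔ k < pushes l
  | [], k => by simp [pushes]
  | true :: l, 0 => by simp [pushes]
  | true :: l, k + 1 => by simpa [pushes, List.count_cons] using nthTrue_lt_length_iff l k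
  | false :: l, k => by simpa [pushes, List.count_cons] using nthTrue_lt_length_iff l k

/-- The letter at the position of the `k`-th push is a push. [folklore] -/
theorem getElem_nthTrue : ∀ (l : List Bool) (k : ℕ) (h : nthTrue l k < l.length), l[nthTrue l k] = true
  | [], k, h => by simp at h
  | true :: l, 0, _ => rfl
  | true :: l, k + 1, h => by
      have h' : nthTrue l k < l.length := by simpa using h
      simpa using getElem_nthTrue l k h'
  | false :: l, k, h => by
      have h' : nthTrue l k < l.length := by simpa using h
      simpa using getElem_nthTrue l k h'

/-- Exactly `k` pushes precede the position of the `k`-th push (when it exists). [folklore] -/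
theorem pushes_take_nthTrue : ∀ (l : List Bool) (k : ℕ), k < pushes l → pushes (l.take (nthTrue l k)) = k
  | [], k, h => by simp [pushes] at h
  | true :: l, 0, _ => by simp [pushes]
  | true :: l, k + 1, h => by
      have h' : k < pushes l := by simpa [pushes, List.count_cons] using h
      simpa [pushes, List.count_cons] using pushes_take_nthTrue l k h'
  | false :: l, k, h => by
      have h' : k < pushes l := by simpa [pushes, List.count_cons] using h
      simpa [pushes, List.count_cons] using pushes_take_nthTrue l k h'

/-- `nthTrue` is stable under appending on the right, as long as the push exists in the prefix. [folklore] -/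
theorem nthTrue_append_of_lt : ∀ (l m : List Bool) (k : ℕ), k < pushes l → nthTrue (l ++ m) k = nthTrue l k
  | [], m, k, h => by simp [pushes] at h
  | true :: l, m, 0, _ => rfl
  | true :: l, m, k + 1, h => by
      have h' : k < pushes l := by simpa [pushes, List.count_cons] using h
      simp [nthTrue_append_of_lt l m k h']
  | false :: l, m, k, h => by
      have h' : k < pushes l := by simpa [pushes, List.count_cons] using h
      simp [nthTrue_append_of_lt l m k h']

/-- Length of the prefix. [folklore] -/
@[simp] theorem length_shedPrefix (t : ℕ) : (shedPrefix R H E y t).length = t := by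
  induction t with
  | zero => rfl
  | succ t ih => simp [shedPrefix, ih]

/-- The prefix recursion, one step. [folklore] -/
theorem shedPrefix_succ (t : ℕ) :
    shedPrefix R H E y (t + 1) = shedPrefix R H E y t ++ [shedLetter R H E y t] := rfl

/-- The prefix of length `t` lists the letters at positions `< t`. [folklore] -/
theorem shedPrefix_eq_map_range (t : ℕ) : shedPrefix R H E y t = (List.range t).map (shedLetter R H E y) := by
  induction t with
  | zero => rfl
  | succ t ih => rw [shedPrefix_succ, ih, List.range_succ, List.map_append, List.map_singleton]

/-- Entries of the prefix. [folklore] -/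
theorem getElem_shedPrefix {t i : ℕ} (h : i < (shedPrefix R H E y t).length) :
    (shedPrefix R H E y t)[i] = shedLetter R H E y i := by
  have hi : i < t := by simpa using h
  simp [shedPrefix_eq_map_range]

/-- Prefixes are nested. [folklore] -/
theorem take_shedPrefix {s t : ℕ} (hst : s ≤ t) : (shedPrefix R H E y t).take s = shedPrefix R H E y s := by
  rw [shedPrefix_eq_map_range, shedPrefix_eq_map_range, ← List.map_take, List.take_range, min_eq_left hst]

/-- The word on the window is the shed letter. [folklore] -/
theorem shedWord_apply (t : Fin N) : shedWord R H E y t = shedLetter R H E y t := rfl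

/-- The bit at a window position. [folklore] -/
@[simp] theorem bit_apply (t : Fin N) : bit y t = y t := by
  simp [bit, t.isLt]

/-- Defect positions PUSH (`R ≡ push`). [folklore] -/
theorem shedLetter_of_isDefect {t : ℕ} (ht : isDefect R t = true) : shedLetter R H E y t = true := by
  unfold shedLetter letter; rw [if_pos ht]

/-- Fill positions push. [folklore] -/
theorem shedLetter_of_lt_fill {t : ℕ} (ht : t < H) : shedLetter R H E y t = true := by
  unfold shedLetter letter
  by_cases hd : isDefect R t = true
  · rw [if_pos hd]
  · rw [if_neg hd, if_pos ht]

/-- An empty queue pushes. [folklore] -/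
theorem shedLetter_of_empty {t : ℕ} (he : pushes (shedPrefix R H E y t) ≤ pops (shedPrefix R H E y t)) :
    shedLetter R H E y t = true := by
  unfold shedLetter letter
  by_cases hd : isDefect R t = true
  · rw [if_pos hd]
  · rw [if_neg hd]
    by_cases hf : t < H
    · rw [if_pos hf]
    · rw [if_neg hf, if_pos he]

/-- Tail letters (non-defect, past the fill, non-empty queue): push iff fewer than `tailPushes` non-defect tail
positions precede. [folklore] -/
theorem shedLetter_tail {t : ℕ} (hd : isDefect R t = false) (hf : H ≤ t)
    (hne : pops (shedPrefix R H E y t) < pushes (shedPrefix R H E y t)) (hE : E ≤ t) :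
    shedLetter R H E y t = decide (freeCount R E t < tailPushes R E (shedPrefix R H E y t)) := by
  unfold shedLetter letter
  rw [if_neg (by simp [hd]), if_neg (not_lt.2 hf), if_neg (not_le.2 hne), if_pos hE]

/-- **Shed**: before the tail, with a non-empty queue whose front item was pushed at a defect, a non-defect
position pops. [folklore] -/
theorem shedLetter_shed {t : ℕ} (hd : isDefect R t = false) (hf : H ≤ t)
    (hne : pops (shedPrefix R H E y t) < pushes (shedPrefix R H E y t)) (hE : t < E)
    (hfront : isDefect R (frontPos (shedPrefix R H E y t)) = true) : shedLetter R H E y t = false := by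
  unfold shedLetter letter
  rw [if_neg (by simp [hd]), if_neg (not_lt.2 hf), if_neg (not_le.2 hne), if_neg (not_le.2 hE), if_pos hfront]

/-- **Fair**: at a fair position the letter is the bit. [folklore] -/
theorem shedLetter_of_isFair {t : ℕ} (h : isFair R H E y t = true) : shedLetter R H E y t = bit y t := by
  simp only [isFair, Bool.and_eq_true, Bool.not_eq_true', decide_eq_true_eq] at h
  obtain ⟨⟨⟨⟨hd, hf⟩, hne⟩, hE⟩, hfront⟩ := h
  unfold shedLetter letter
  rw [if_neg (by simp [hd]), if_neg (not_lt.2 hf), if_neg (not_le.2 hne), if_neg (not_le.2 hE),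
    if_neg (by simp [hfront])]

/-- A pop letter only occurs at a non-defect position past the fill with a non-empty queue. [folklore] -/
theorem pops_lt_pushes_of_shedLetter_eq_false {t : ℕ} (h : shedLetter R H E y t = false) :
    isDefect R t = false ∧ H ≤ t ∧ pops (shedPrefix R H E y t) < pushes (shedPrefix R H E y t) := by
  by_contra hcon
  have : shedLetter R H E y t = true := by
    by_cases hd : isDefect R t = true
    · exact shedLetter_of_isDefect R H E y hd
    rw [Bool.not_eq_true] at hd
    by_cases hf : t < H
    · exact shedLetter_of_lt_fill R H E y hf
    exact shedLetter_of_empty R H E y (not_lt.1 fun hne => hcon ⟨hd, not_lt.1 hf, hne⟩)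
  rw [this] at h
  exact Bool.noConfusion h

/-- **Prefix condition**: after every prefix, pops never exceed pushes (the queue length is `pushes − pops`).
[folklore] -/
theorem pops_le_pushes (t : ℕ) : pops (shedPrefix R H E y t) ≤ pushes (shedPrefix R H E y t) := by
  induction t with
  | zero => simp [shedPrefix]
  | succ t ih =>
    rw [shedPrefix_succ, pushes_append_singleton, pops_append_singleton]
    cases h : shedLetter R H E y t
    · have := (pops_lt_pushes_of_shedLetter_eq_false R H E y h).2.2
      simp; omega
    · simp; omega

/-- A small sanity check of the letter rule on a window of length `8` with one defect at position `3`, fill `2`,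
tail from `6`: the prefix recursion computes. [folklore] -/
example : shedPrefix ({⟨3, by omega⟩} : Finset (Fin 8)) 2 6 (fun _ => false) 8 =
    [true, true, false, true, false, false, true, false] := by
  decide

end Summit.ValiantsHypothesis.ValiantsHypothesis.Theorems.FifoMatching.NNLinearDegreeCofactorHard.ShedWord
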